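import Mathlib
import Summits.Ventures.HodgeRepro.Tier4.Line4.FinNVPhase
import Summits.Ventures.HodgeRepro.Tier4.Line4.MainTermSplitInvariance
import Summits.Ventures.HodgeRepro.Tier4.Line4.LevelIndexBound

/-!
# Tier4/Line4/FinNVGlue — C-L4-FINNV-GLUE: the finite non-vanishing (S-FIN-NV) in NORM FORM, assembled from the
`p`-split of the main-term integral, the `p`-split of the unit and PHASE-AT-P

Blind re-derivation cell `pub-hodge-repro`, Tier 4 «prove the step» (README §9–§10), LINE L4, seat t4-L4-x2 (g0, the
extra prover seat; plan-4 g6's cut S15792 + the R-DZF-OF-RECORD correction S15796; statement S15810).  Tree path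
`lean/Summits/Ventures/HodgeRepro/Tier4/Line4/FinNVGlue.lean`.  Imports this seat's FinNVPhase (the pieces; through it
x2's MainTermSplit, L2-p1's SuppMeasureSplit, L2-p3's SuppMeasureTranslate, L4-p1's LevelPhaseAtP), x2's
MainTermSplitInvariance (`setIntegral_chi_innerFin_levelDC_eq_mul_of_fundamentalDomain`, way (β)) and L4-p2's
LevelIndexBound (`natSize_lt_one_iff_mem`).  Mathlib-level; no literature.

WHAT IS PROVED.  TailGlueMain's `hnv` binder (the (7b) glue's (S-FIN-NV), bd52e6ad59539fe8 L191–L193),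
`∃ δ > 0, ∃ N₀, ∀ N ≥ N₀, δ · suppMeasure(p^{N+n₁}) γ₀ ≤ ‖∫_{DZ_f} χ(b) · I_f(levelDC (p^{N+n₁})) γ₀ b dν_f‖`,
is a THEOREM (`finnv_of_pPhase_of_split`) from
* the factorisation `∫_{DZ_f} = (c c′) · I_S(n) · c₀(γ₀)` at the glue's `DZ_f` (x2's
  `setIntegral_chi_innerFin_levelDC_eq_mul_of_fundamentalDomain`, way (β): `hfd'`);
* the factorisation of the unit `suppMeasure(p^n) = (c c′) · vol_S(n) · vol^{(S)}(1)` at the PRODUCT domain (L2-p1's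
  `suppMeasure_eq_mul` + `suppMeasureAway_pow_eq`), carried to the glue's `DZ_f` by `suppMeasure_eq_of_isFundamentalDomain`;
* THE PHASE-INTEGRAL BOUND `norm_localFactorAt_ge` (FinNVPhase): `‖I_S(n)‖ ≥ (1 − ε) · vol_S(n)` once the `S`-part phase
  is `ε`-close to `1` on the `DZ_S`-cut level fibre;
* PHASE-AT-P (L4-p1's `exists_level_pPhase_close`): `‖pPhase − 1‖ < ½` on the level fibres of `γ₀` from some level on;
  the fibre pairs of `suppSetAt` are transported into `suppSet` through ONE away pair `(y, y′) ∈ suppSetAway(1) ∩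
  DZ^{(S)} × T′^{(S)}`, which exists because `awayOrbital ≠ 0` (`exists_mem_suppSetAway_of_awayOrbital_ne_zero`).
The constant is `δ := ½ · ‖c₀(γ₀)‖ / vol^{(S)}(1)`, `N₀` PHASE-AT-P's level; `finnv_of_pPhase_of_split_plain` restates it at
the PLAIN levels `p ^ M` (the binder form of TailPieces / TailAssembly).  The finiteness and positivity of the unit and of
its two factors come from the glue's own (S-UNIT) `hv`.
DISPLAYED, never proved here: `haway : awayOrbital ≠ 0` (the `∏_{v ∉ S} J_v(γ₀) ≠ 0` conjunct of the `γ₀`-existence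
display), `hsub`/`C` (the fibre compactness of PHASE-AT-P), `hfd'` (the product domain is a `Z(k)`-fundamental domain),
`hint`/`hB` (`ChainInputs`' `hIfin`/`hB` at each level), `hv` ((S-UNIT)).

Nothing here says anything about the status of the Hodge conjecture for CM abelian varieties, which is NOT proved
(HC_CM is NOT proved by anyone in this repository).
-/

set_option autoImplicit false

noncomputable section

namespace Summit.Ventures.HodgeRepro.Tier4.Line4

open Summit.Ventures.HodgeRepro.Tier4 Summit.Ventures.HodgeRepro.Tier4.Common
  Summit.Ventures.HodgeRepro.Tier4.Line1 NumberField IsDedekindDomain MeasureTheory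

open scoped NumberField ComplexConjugate NNReal ENNReal

section Assembly

variable {k : Type} [Field k] [NumberField k] (W : PlaneData k) [MeasurableSpace (GA W)] [BorelSpace (GA W)]
  (R : RTFData W)

/-- **C-L4-FINNV-GLUE — (S-FIN-NV) IN NORM FORM** (TailGlueMain's `hnv` verbatim): for the `p`-split data of record
(Haar normalisations `ν_f = c (ν_S ⊗ ν^{(S)})`, `ν′_f = c′ (ν′_S ⊗ ν′^{(S)})`, `S` the places above `p`), ANY
`Z(k)`-fundamental domain `DZ_f` of `T_f` (the glue's), a product-shaped fundamental domain `torusFinSplit⁻¹(DZ_S × DZ^{(S)})`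
(`hfd'`), PHASE-AT-P's fibre compactness (`C`, `hsub`), the display `awayOrbital ≠ 0`, the glue's (S-UNIT) `hv` and the
chain's two integrability clauses at each level (`hint`, `hB`):
`∃ δ > 0, ∃ N₀, ∀ N ≥ N₀, δ · suppMeasure(p^{N+n₁}) γ₀ ≤ ‖∫_{DZ_f} χ(b) · I_f(levelDC(p^{N+n₁})) γ₀ b dν_f‖`,
with `δ := ½ · ‖awayOrbital‖ / vol^{(S)}(1)`. -/
theorem finnv_of_pPhase_of_split (hc : Continuous R.chi) (hu : ∀ a, ‖R.chi a‖ = 1) (hc' : Continuous R.chi')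
    (hu' : ∀ a, ‖R.chi' a‖ = 1)
    (γ₀ : rationalPoints W) (hlin : IsLinRegular W γ₀) (p n₁ : ℕ) (hp : p ≠ 0)
    (νf : Measure (torusFin W)) [νf.IsHaarMeasure] (νf' : Measure (torusFin' W)) [νf'.IsHaarMeasure]
    (νS : Measure (torusFinAt W (placesAbove (k := k) p))) [νS.IsHaarMeasure]
    (νA : Measure (torusFinAway W (placesAbove (k := k) p))) [νA.IsHaarMeasure]
    (c : ℝ≥0) (hc0 : 0 < c)
    (hcν : νf = c • Measure.map (torusFinSplit W (placesAbove (k := k) p)).symm (νS.prod νA))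
    (νS' : Measure (torusFinAt' W (placesAbove (k := k) p))) [νS'.IsHaarMeasure]
    (νA' : Measure (torusFinAway' W (placesAbove (k := k) p))) [νA'.IsHaarMeasure]
    (c' : ℝ≥0) (hc0' : 0 < c')
    (hcν' : νf' = c' • Measure.map (torusFinSplit' W (placesAbove (k := k) p)).symm (νS'.prod νA'))
    (DZf : Set (torusFin W)) (hDZf : MeasurableSet DZf) (hfd : IsFundamentalDomain (centreFin W) DZf νf)
    (DZS : Set (torusFinAt W (placesAbove (k := k) p))) (hDZS : MeasurableSet DZS)
    (DZA : Set (torusFinAway W (placesAbove (k := k) p))) (hDZA : MeasurableSet DZA)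
    (hfd' : IsFundamentalDomain (centreFin W) ((torusFinSplit W (placesAbove (k := k) p)) ⁻¹' (DZS ×ˢ DZA)) νf)
    (C : Set (torusFin W × torusFin' W)) (hC : IsCompact C)
    (hsub : ∀ N ≥ n₁, ∀ q ∈ suppSet W (γ₀ : GA W) (p ^ N) (γ₀ : GA W),
      q.1 ∈ (torusFinSplit W (placesAbove (k := k) p)) ⁻¹' (DZS ×ˢ DZA) → q ∈ C)
    (haway : awayOrbital W (placesAbove (k := k) p) R (γ₀ : GA W) νA νA' DZA ≠ 0)
    (hv : ∀ N : ℕ, 0 < (suppMeasure W νf νf' (γ₀ : GA W) DZf (p ^ (N + n₁)) (γ₀ : GA W)).toReal)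
    (hint : ∀ N : ℕ, IntegrableOn (fun b : torusFin W =>
      R.chi b * innerFin W R (levelDC W (γ₀ : GA W) (p ^ (N + n₁))) (γ₀ : GA W) νf' b) DZf νf)
    (hB : ∀ (N : ℕ) (t : torusT W), Integrable (fun b' : torusFin' W => conj (R.chi' b') *
      levelDC W (γ₀ : GA W) (p ^ (N + n₁))
        ((GA.ofFinPart W t)⁻¹ * GA.ofFinPart W (γ₀ : GA W) * ((b' : torusT' W) : GA W))) νf') :
    ∃ δ : ℝ, 0 < δ ∧ ∃ N₀ : ℕ, ∀ N ≥ N₀,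
      δ * (suppMeasure W νf νf' (γ₀ : GA W) DZf (p ^ (N + n₁)) (γ₀ : GA W)).toReal ≤
        ‖∫ b in DZf, R.chi b * innerFin W R (levelDC W (γ₀ : GA W) (p ^ (N + n₁))) (γ₀ : GA W) νf' b ∂νf‖ := by
  have hDZf'm : MeasurableSet ((torusFinSplit W (placesAbove (k := k) p)) ⁻¹' (DZS ×ˢ DZA)) :=
    measurableSet_preimage_torusFinSplit_prod W (placesAbove (k := k) p) hDZS hDZA
  -- the away point
  obtain ⟨y, hy, y', hyy'⟩ := exists_mem_suppSetAway_of_awayOrbital_ne_zero W (placesAbove (k := k) p) R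
    (γ₀ : GA W) νA νA' DZA haway
  have hcc : ((c : ENNReal) * (c' : ENNReal)) ≠ 0 :=
    mul_ne_zero (by exact_mod_cast hc0.ne') (by exact_mod_cast hc0'.ne')
  -- the unit at level `p^(N+n₁)` factors through the product domain
  have hunit : ∀ N : ℕ,
      suppMeasure W νf νf' (γ₀ : GA W) DZf (p ^ (N + n₁)) (γ₀ : GA W) =
        ((c : ENNReal) * c') *
          (suppMeasureAt W (placesAbove (k := k) p) (γ₀ : GA W) (p ^ (N + n₁)) (γ₀ : GA W) νS νS' DZS *
            suppMeasureAway W (placesAbove (k := k) p) (γ₀ : GA W) 1 (γ₀ : GA W) νA νA' DZA) := by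
    intro N
    have hn : p ^ (N + n₁) ≠ 0 := pow_ne_zero _ hp
    rw [suppMeasure_eq_of_isFundamentalDomain W νf νf' (γ₀ : GA W) hn hDZf hDZf'm hfd hfd' (γ₀ : GA W),
      suppMeasure_eq_mul W (placesAbove (k := k) p) (γ₀ : GA W) (p ^ (N + n₁)) (γ₀ : GA W) νf νf' νS νS' νA νA' c c'
        hcν hcν' hn DZS DZA hDZS hDZA, suppMeasureAway_pow_eq]
  -- name the away measure at level one
  obtain ⟨Aw1, hAw1⟩ : ∃ x : ENNReal,
      suppMeasureAway W (placesAbove (k := k) p) (γ₀ : GA W) 1 (γ₀ : GA W) νA νA' DZA = x := ⟨_, rfl⟩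
  rw [hAw1] at hunit
  -- every factor of the unit is finite and positive
  have hfacts : ∀ N : ℕ,
      suppMeasureAt W (placesAbove (k := k) p) (γ₀ : GA W) (p ^ (N + n₁)) (γ₀ : GA W) νS νS' DZS ≠ 0 ∧
      suppMeasureAt W (placesAbove (k := k) p) (γ₀ : GA W) (p ^ (N + n₁)) (γ₀ : GA W) νS νS' DZS ≠ ⊤ ∧
      Aw1 ≠ 0 ∧ Aw1 ≠ ⊤ := by
    intro N
    obtain ⟨hu0, hutop⟩ := ENNReal.toReal_pos_iff.1 (hv N)
    rw [hunit N] at hu0 hutop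
    obtain ⟨At, hAt⟩ : ∃ x : ENNReal,
        suppMeasureAt W (placesAbove (k := k) p) (γ₀ : GA W) (p ^ (N + n₁)) (γ₀ : GA W) νS νS' DZS = x := ⟨_, rfl⟩
    rw [hAt] at hu0 hutop ⊢
    have hAt0 : At ≠ 0 := by
      intro h
      rw [h, zero_mul, mul_zero] at hu0
      exact lt_irrefl _ hu0
    have hAw0 : Aw1 ≠ 0 := by
      intro h
      rw [h, mul_zero, mul_zero] at hu0
      exact lt_irrefl _ hu0
    have hAttop : At ≠ ⊤ := by
      intro h
      rw [h, ENNReal.top_mul hAw0, ENNReal.mul_top hcc] at hutop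
      exact lt_irrefl _ hutop
    have hAwtop : Aw1 ≠ ⊤ := by
      intro h
      rw [h, ENNReal.mul_top hAt0, ENNReal.mul_top hcc] at hutop
      exact lt_irrefl _ hutop
    exact ⟨hAt0, hAttop, hAw0, hAwtop⟩
  have hAw0 : Aw1 ≠ 0 := (hfacts 0).2.2.1
  have hAwtop : Aw1 ≠ ⊤ := (hfacts 0).2.2.2
  have hmAw : 0 < Aw1.toReal := ENNReal.toReal_pos hAw0 hAwtop
  have hAO : 0 < ‖awayOrbital W (placesAbove (k := k) p) R (γ₀ : GA W) νA νA' DZA‖ := norm_pos_iff.2 haway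
  -- PHASE-AT-P at the product domain
  have hS : ∀ v, v ∈ placesAbove (k := k) p → natSize k v p < 1 := fun v hv =>
    (natSize_lt_one_iff_mem v p).2 ((mem_placesAbove p v).1 hv)
  obtain ⟨N₀, hN₀⟩ := exists_level_pPhase_close W R (placesAbove (k := k) p) hp hS hlin hc hu hc'
    ((torusFinSplit W (placesAbove (k := k) p)) ⁻¹' (DZS ×ˢ DZA)) C hC n₁ hsub (ε := 1 / 2) (by norm_num)
  refine ⟨(1 / 2) * ‖awayOrbital W (placesAbove (k := k) p) R (γ₀ : GA W) νA νA' DZA‖ / Aw1.toReal,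
    div_pos (mul_pos (by norm_num) hAO) hmAw, N₀, fun N hN => ?_⟩
  have hn : p ^ (N + n₁) ≠ 0 := pow_ne_zero _ hp
  obtain ⟨hAt0, hAttop, -, -⟩ := hfacts N
  -- the phase is `½`-close to `1` on the `DZ_S`-cut `S`-support set at this level
  have hphase : ∀ x ∈ DZS, ∀ x' : torusFinAt' W (placesAbove (k := k) p),
      (x, x') ∈ suppSetAt W (placesAbove (k := k) p) (γ₀ : GA W) (p ^ (N + n₁)) (γ₀ : GA W) →
      ‖R.chi ((x : torusFin W) : torusT W) * conj (R.chi' ((x' : torusFin' W) : torusT' W)) - 1‖ ≤ 1 / 2 := by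
    intro x hx x' hxx'
    -- the away pair at this level
    have hyy'n : (y, y') ∈ suppSetAway W (placesAbove (k := k) p) (γ₀ : GA W) (p ^ (N + n₁)) (γ₀ : GA W) := by
      rw [suppSetAway_pow_eq]
      exact hyy'
    -- the full pair
    obtain ⟨b, hb⟩ : ∃ b : torusFin W, (torusFinSplit W (placesAbove (k := k) p)).symm (x, y) = b := ⟨_, rfl⟩
    obtain ⟨b', hb'⟩ : ∃ b' : torusFin' W, (torusFinSplit' W (placesAbove (k := k) p)).symm (x', y') = b' :=
      ⟨_, rfl⟩
    have hsb : torusFinSplit W (placesAbove (k := k) p) b = (x, y) := by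
      rw [← hb, ContinuousMulEquiv.apply_symm_apply]
    have hsb' : torusFinSplit' W (placesAbove (k := k) p) b' = (x', y') := by
      rw [← hb', ContinuousMulEquiv.apply_symm_apply]
    rw [torusFinSplit_apply] at hsb
    rw [torusFinSplit'_apply] at hsb'
    have hb1 : atTf W (placesAbove (k := k) p) b = x := (Prod.ext_iff.1 hsb).1
    have hb2 : awayTf W (placesAbove (k := k) p) b = y := (Prod.ext_iff.1 hsb).2
    have hb'1 : atTf' W (placesAbove (k := k) p) b' = x' := (Prod.ext_iff.1 hsb').1
    have hb'2 : awayTf' W (placesAbove (k := k) p) b' = y' := (Prod.ext_iff.1 hsb').2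
    have hq : (b, b') ∈ suppSet W (γ₀ : GA W) (p ^ (N + n₁)) (γ₀ : GA W) := by
      rw [mem_suppSet_iff_parts W (placesAbove (k := k) p), hb1, hb2, hb'1, hb'2]
      exact ⟨hxx', hyy'n⟩
    have hq1 : (b, b').1 ∈ (torusFinSplit W (placesAbove (k := k) p)) ⁻¹' (DZS ×ˢ DZA) := by
      show torusFinSplit W (placesAbove (k := k) p) b ∈ DZS ×ˢ DZA
      rw [torusFinSplit_apply, hb1, hb2]
      exact ⟨hx, hy⟩
    have hph := hN₀ (N + n₁) (le_trans hN (Nat.le_add_right N n₁)) (b, b') hq hq1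
    -- the `S`-part phase of `(b, b′)` is the phase of `(x, x′)`
    have hbS : GA.ofPlacesPart W (placesAbove (k := k) p) ((b : torusT W) : GA W) =
        (((x : torusFin W) : torusT W) : GA W) := by
      rw [← hb, torusFinSplit_symm_apply]
      simp only [Subgroup.coe_mul]
      rw [ofPlacesPart_mul, ofPlacesPart_eq_self_of_mem_supportedOn W _ (coe_torusFinAt_mem_supportedOn W _ x),
        ofPlacesPart_eq_one_of_mem_trivialOn W _ (coe_torusFinAway_mem_trivialOn W _ y), mul_one]
    have hb'S : GA.ofPlacesPart W (placesAbove (k := k) p) ((b' : torusT' W) : GA W) =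
        (((x' : torusFin' W) : torusT' W) : GA W) := by
      rw [← hb', torusFinSplit'_symm_apply]
      simp only [Subgroup.coe_mul]
      rw [ofPlacesPart_mul, ofPlacesPart_eq_self_of_mem_supportedOn W _ (coe_torusFinAt'_mem_supportedOn W _ x'),
        ofPlacesPart_eq_one_of_mem_trivialOn W _ (coe_torusFinAway'_mem_trivialOn W _ y'), mul_one]
    rw [pPhase_eq_of_ofPlacesPart W (placesAbove (k := k) p) R (b, b') ((x : torusFin W) : torusT W)
      ((x' : torusFin' W) : torusT' W) hbS hb'S] at hph
    exact hph.le
  have hL := norm_localFactorAt_ge W (placesAbove (k := k) p) R (γ₀ : GA W) (p ^ (N + n₁)) νS νS' hc hu hc' hu' hn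
    DZS hAttop hphase
  -- the main-term integral factors
  have hsplit : ∫ b in DZf, R.chi b * innerFin W R (levelDC W (γ₀ : GA W) (p ^ (N + n₁))) (γ₀ : GA W) νf' b ∂νf =
      ((c : ℂ) * (c' : ℂ)) * localFactorAt W (placesAbove (k := k) p) R (γ₀ : GA W) (p ^ (N + n₁)) νS νS' DZS *
        awayOrbital W (placesAbove (k := k) p) R (γ₀ : GA W) νA νA' DZA :=
    setIntegral_chi_innerFin_levelDC_eq_mul_of_fundamentalDomain W R (γ₀ : GA W) hu p (N + n₁) νf νS νA c hcν νf'
      νS' νA' c' hcν' DZf hfd DZS hDZS DZA hDZA hfd' (hint N) (hB N)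
  -- the unit in real form
  have hureal : (suppMeasure W νf νf' (γ₀ : GA W) DZf (p ^ (N + n₁)) (γ₀ : GA W)).toReal =
      (c : ℝ) * (c' : ℝ) *
        ((suppMeasureAt W (placesAbove (k := k) p) (γ₀ : GA W) (p ^ (N + n₁)) (γ₀ : GA W) νS νS' DZS).toReal *
          Aw1.toReal) := by
    rw [hunit N, ENNReal.toReal_mul, ENNReal.toReal_mul, ENNReal.toReal_mul, ENNReal.coe_toReal, ENNReal.coe_toReal]
  rw [hsplit, hureal, norm_mul, norm_mul, norm_mul, Complex.norm_real, Complex.norm_real, Real.norm_eq_abs,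
    Real.norm_eq_abs, NNReal.abs_eq, NNReal.abs_eq]
  -- name the three real quantities
  obtain ⟨mAt, hmAt⟩ : ∃ x : ℝ,
      (suppMeasureAt W (placesAbove (k := k) p) (γ₀ : GA W) (p ^ (N + n₁)) (γ₀ : GA W) νS νS' DZS).toReal = x :=
    ⟨_, rfl⟩
  obtain ⟨nL, hnL⟩ : ∃ x : ℝ,
      ‖localFactorAt W (placesAbove (k := k) p) R (γ₀ : GA W) (p ^ (N + n₁)) νS νS' DZS‖ = x := ⟨_, rfl⟩
  obtain ⟨nA, hnA⟩ : ∃ x : ℝ, ‖awayOrbital W (placesAbove (k := k) p) R (γ₀ : GA W) νA νA' DZA‖ = x := ⟨_, rfl⟩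
  rw [hmAt, hnL] at hL
  rw [hmAt, hnL, hnA]
  rw [hnA] at hAO
  have hmAt0 : 0 ≤ mAt := hmAt ▸ ENNReal.toReal_nonneg
  have hmAw' : Aw1.toReal ≠ 0 := hmAw.ne'
  have hc0r : (0 : ℝ) ≤ c := c.2
  have hc0r' : (0 : ℝ) ≤ c' := c'.2
  calc (1 / 2) * nA / Aw1.toReal * ((c : ℝ) * (c' : ℝ) * (mAt * Aw1.toReal)) =
        (c : ℝ) * (c' : ℝ) * ((1 - 1 / 2) * mAt) * nA := by
          field_simp
          ring
    _ ≤ (c : ℝ) * (c' : ℝ) * nL * nA := by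
          have h1 : 0 ≤ (c : ℝ) * (c' : ℝ) := mul_nonneg hc0r hc0r'
          exact mul_le_mul_of_nonneg_right (mul_le_mul_of_nonneg_left hL h1) hAO.le

/-- **(S-FIN-NV) IN NORM FORM AT PLAIN LEVELS `p ^ M`** (the binder form of x2's TailPieces / L2-p2's TailAssembly, every input
level-indexed by the plain level): `finnv_of_pPhase_of_split` with the threshold `n₁` of PHASE-AT-P's fibre compactness
absorbed into `M₀`; `hv`, `hint`, `hB` are asked at every level `p ^ M`. -/
theorem finnv_of_pPhase_of_split_plain (hc : Continuous R.chi) (hu : ∀ a, ‖R.chi a‖ = 1) (hc' : Continuous R.chi')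
    (hu' : ∀ a, ‖R.chi' a‖ = 1)
    (γ₀ : rationalPoints W) (hlin : IsLinRegular W γ₀) (p n₁ : ℕ) (hp : p ≠ 0)
    (νf : Measure (torusFin W)) [νf.IsHaarMeasure] (νf' : Measure (torusFin' W)) [νf'.IsHaarMeasure]
    (νS : Measure (torusFinAt W (placesAbove (k := k) p))) [νS.IsHaarMeasure]
    (νA : Measure (torusFinAway W (placesAbove (k := k) p))) [νA.IsHaarMeasure]
    (c : ℝ≥0) (hc0 : 0 < c)
    (hcν : νf = c • Measure.map (torusFinSplit W (placesAbove (k := k) p)).symm (νS.prod νA))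
    (νS' : Measure (torusFinAt' W (placesAbove (k := k) p))) [νS'.IsHaarMeasure]
    (νA' : Measure (torusFinAway' W (placesAbove (k := k) p))) [νA'.IsHaarMeasure]
    (c' : ℝ≥0) (hc0' : 0 < c')
    (hcν' : νf' = c' • Measure.map (torusFinSplit' W (placesAbove (k := k) p)).symm (νS'.prod νA'))
    (DZf : Set (torusFin W)) (hDZf : MeasurableSet DZf) (hfd : IsFundamentalDomain (centreFin W) DZf νf)
    (DZS : Set (torusFinAt W (placesAbove (k := k) p))) (hDZS : MeasurableSet DZS)
    (DZA : Set (torusFinAway W (placesAbove (k := k) p))) (hDZA : MeasurableSet DZA)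
    (hfd' : IsFundamentalDomain (centreFin W) ((torusFinSplit W (placesAbove (k := k) p)) ⁻¹' (DZS ×ˢ DZA)) νf)
    (C : Set (torusFin W × torusFin' W)) (hC : IsCompact C)
    (hsub : ∀ N ≥ n₁, ∀ q ∈ suppSet W (γ₀ : GA W) (p ^ N) (γ₀ : GA W),
      q.1 ∈ (torusFinSplit W (placesAbove (k := k) p)) ⁻¹' (DZS ×ˢ DZA) → q ∈ C)
    (haway : awayOrbital W (placesAbove (k := k) p) R (γ₀ : GA W) νA νA' DZA ≠ 0)
    (hv : ∀ M : ℕ, 0 < (suppMeasure W νf νf' (γ₀ : GA W) DZf (p ^ M) (γ₀ : GA W)).toReal)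
    (hint : ∀ M : ℕ, IntegrableOn (fun b : torusFin W =>
      R.chi b * innerFin W R (levelDC W (γ₀ : GA W) (p ^ M)) (γ₀ : GA W) νf' b) DZf νf)
    (hB : ∀ (M : ℕ) (t : torusT W), Integrable (fun b' : torusFin' W => conj (R.chi' b') *
      levelDC W (γ₀ : GA W) (p ^ M)
        ((GA.ofFinPart W t)⁻¹ * GA.ofFinPart W (γ₀ : GA W) * ((b' : torusT' W) : GA W))) νf') :
    ∃ δ : ℝ, 0 < δ ∧ ∃ M₀ : ℕ, ∀ M ≥ M₀,
      δ * (suppMeasure W νf νf' (γ₀ : GA W) DZf (p ^ M) (γ₀ : GA W)).toReal ≤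
        ‖∫ b in DZf, R.chi b * innerFin W R (levelDC W (γ₀ : GA W) (p ^ M)) (γ₀ : GA W) νf' b ∂νf‖ := by
  obtain ⟨δ, hδ, N₀, h⟩ := finnv_of_pPhase_of_split W R hc hu hc' hu' γ₀ hlin p n₁ hp νf νf' νS νA c hc0 hcν νS' νA'
    c' hc0' hcν' DZf hDZf hfd DZS hDZS DZA hDZA hfd' C hC hsub haway (fun N => hv (N + n₁)) (fun N => hint (N + n₁))
    (fun N => hB (N + n₁))
  refine ⟨δ, hδ, N₀ + n₁, fun M hM => ?_⟩
  have h' := h (M - n₁) (by omega)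
  rwa [Nat.sub_add_cancel (by omega : n₁ ≤ M)] at h'

end Assembly

end Summit.Ventures.HodgeRepro.Tier4.Line4

end
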